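import Mathlib
import Literature.Analysis.FluidPDE.Tao2016AveragedNS.LocalCascadeSolutions
import Literature.Analysis.FluidPDE.Tao2016AveragedNS.RenormalisedCascadeWaves
import Literature.Analysis.FluidPDE.Tao2016AveragedNS.SelfSimilarCascadeBlowup
import HarnessLib

/-!
# Crux `TaoLadderRungTwoBreak.EternalRigidityViscBddOne` (stmt-NavierStokesRegularity-20420): the binder
# vocabulary of the REGISTERED skeleton `EternalRigidityViscBddOne_birth.lean` (sha16 `85fbfe8e90eea58b`)

D-0017 `<RouteSlug>Defs`: the objects the registered birth skeleton of K2ᵛ(1) POSITS — theory-2's local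
vocabulary `ViscousUpTo` / `BlowsUpAt` / `TypeOne` (a regular solution of the exact `ν`-viscous NS-scaled
lattice of a table from a one-shell datum on `[0, t⋆)`; blow-up of the (4.5)-weighted sup-norm at `t⋆`; the
scale-critical (type-I) rate bound), moved VERBATIM (bodies byte-identical; only the namespace prefix changes
from `…Cruxes.EternalRigidityViscBddOne.Birth` to `…Theorems.EternalRigidityViscBddOne.Birth`) together with
the skeleton's two consistency lemmas against the tree's `ViscousGlobal`, so that the three registered stubs
`stub_viscousBlowup` / `stub_typeOne` / `stub_eternalLimitViscBdd` can be stated — and closed — BY NAME from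
`Theorems/`.  (The skeleton announced these as «definition requests if the line is adopted».)

MODEL lattice ODEs of Tao 2016 §4 only.  WHAT THIS IS NOT: not NS — DEFINITIONS ONLY plus two one-line
consistency lemmas; nothing is claimed about any table; the crux 20420 stays OPEN.
-/

noncomputable section

-- the sub-problem namespace repeats the summit name by design (D-0017)
set_option linter.dupNamespace false

namespace Summit.NavierStokesRegularity.NavierStokesRegularity.Theorems.EternalRigidityViscBddOne.Birth

open Set
open Literature.Analysis.FluidPDE Literature.Analysis.FluidPDE.TaoCascade

/-- A REGULAR solution of the exact `ν`-viscous NS-scaled lattice of the table `α` from the one-shell datum `X₀` at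
shell `0`, on `[0, t⋆)` (theory-2 K2InfOmega v4, verbatim; registered skeleton `85fbfe8e90eea58b` of crux
`EternalRigidityViscBddOne`): `C¹` on `[0,t⋆)`, the (4.5)-weighted a-priori bound on every `[0,T]`, `T < t⋆`, exact
motion, no low shells.  The tree's `ViscousGlobal` is the case `t⋆ = +∞` (`viscousUpTo_of_viscousGlobal`).
[cite: Tao2016AveragedNS, §4, the viscous equation displayed before Thm. 4.2 with Lemma 4.1 (4.5), (4.7), (4.11); cell vocabulary] -/
structure ViscousUpTo (ε₀ ν : ℝ) {m : ℕ} (α : Fin m → Fin m → Fin m → ℤ × ℤ × ℤ → ℝ)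
    (X₀ : Fin m → ℝ) (X : Fin m → ℤ → ℝ → ℝ) (tStar : ℝ) : Prop where
  pos : 0 < tStar
  contDiffOn : ∀ i n, ContDiffOn ℝ 1 (X i n) (Ico 0 tStar)
  apriori : ∀ T : ℝ, 0 < T → T < tStar → ∃ M : ℝ, ∀ t ∈ Icc 0 T, ∀ (i : Fin m) (n : ℤ),
    (1 + (1 + ε₀) ^ ((10 : ℝ) * n)) * |X i n t| ≤ M
  init : ∀ i n, X i n 0 = if n = 0 then X₀ i else 0
  motion : ∀ i n t, 0 ≤ t → t < tStar →
    derivWithin (X i n) (Ici 0) t =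
      quadTerm ε₀ α X i n t - ν * (1 + ε₀) ^ ((2 : ℝ) * n) * X i n t
  noLow : ∀ i n t, n < 0 → 0 ≤ t → t < tStar → X i n t = 0

/-- Blow-up at `t⋆` (verbatim from the registered skeleton): the (4.5)-weighted sup-norm
`sup_{i,n} (1 + (1+ε₀)^{10n}) |X_{i,n}(t)|` is unbounded on `[0, t⋆)`.
[cite: Tao2016AveragedNS, §4 Lemma 4.1 (4.5); cell vocabulary] -/
def BlowsUpAt (ε₀ : ℝ) {m : ℕ} (X : Fin m → ℤ → ℝ → ℝ) (tStar : ℝ) : Prop :=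
  ∀ M : ℝ, ∃ t : ℝ, 0 ≤ t ∧ t < tStar ∧ ∃ (i : Fin m) (n : ℤ),
    M < (1 + (1 + ε₀) ^ ((10 : ℝ) * n)) * |X i n t|

/-- Type I (verbatim from the registered skeleton): the scale-critical rate bound
`Λ^n |X_{i,n}(t)| (t⋆ - t) ≤ C` on `[0, t⋆)` (the renormalised trajectory is bounded).
[cite: Tao2016AveragedNS, §4 (4.1) and §6.4 (self-similar variables); cell vocabulary] -/
def TypeOne (ε₀ : ℝ) {m : ℕ} (X : Fin m → ℤ → ℝ → ℝ) (tStar : ℝ) : Prop :=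
  ∃ C : ℝ, ∀ t : ℝ, 0 ≤ t → t < tStar → ∀ (i : Fin m) (n : ℤ),
    bigLam ε₀ ^ n * |X i n t| * (tStar - t) ≤ C

/-- Consistency with the tree (verbatim from the registered skeleton): a global regular viscous solution is
regular up to every `t⋆ > 0`.
[cite: Tao2016AveragedNS, §4, the viscous equation before Thm. 4.2; cell vocabulary] -/
theorem viscousUpTo_of_viscousGlobal {ε₀ ν : ℝ} {m : ℕ}
    {α : Fin m → Fin m → Fin m → ℤ × ℤ × ℤ → ℝ} {X₀ : Fin m → ℝ} {X : Fin m → ℤ → ℝ → ℝ}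
    (h : ViscousGlobal ε₀ ν α X₀ X) {tStar : ℝ} (ht : 0 < tStar) :
    ViscousUpTo ε₀ ν α X₀ X tStar where
  pos := ht
  contDiffOn := fun i n => (h.contDiffOn i n).mono Ico_subset_Ici_self
  apriori := fun T hT _ => h.apriori T hT
  init := h.init
  motion := fun i n t ht0 _ => h.motion i n t ht0
  noLow := fun i n t hn ht0 _ => h.noLow i n t hn ht0

/-- … and never blows up at a finite `t⋆` (verbatim from the registered skeleton).
[cite: Tao2016AveragedNS, §4, the viscous equation before Thm. 4.2 with Lemma 4.1 (4.5); cell vocabulary] -/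
theorem not_blowsUpAt_of_viscousGlobal {ε₀ ν : ℝ} {m : ℕ}
    {α : Fin m → Fin m → Fin m → ℤ × ℤ × ℤ → ℝ} {X₀ : Fin m → ℝ} {X : Fin m → ℤ → ℝ → ℝ}
    (h : ViscousGlobal ε₀ ν α X₀ X) {tStar : ℝ} (ht : 0 < tStar) : ¬ BlowsUpAt ε₀ X tStar := by
  intro hB
  obtain ⟨M, hM⟩ := h.apriori tStar ht
  obtain ⟨t, ht0, htt, i, n, hlt⟩ := hB M
  exact absurd (hM t ⟨ht0, htt.le⟩ i n) (not_le.2 hlt)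

end Summit.NavierStokesRegularity.NavierStokesRegularity.Theorems.EternalRigidityViscBddOne.Birth

end
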